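import Mathlib.Analysis.Convex.Deriv
import Summits.HubbardSuperconductivity.HubbardSuperconductivity.Theorems.ThermalWedgeTwSeededEnsembleEquivalenceRFreeColdEdgeReduction

/-!
# Crux `TwSeededEnsembleEquivalenceR` (stmt-HubbardSuperconductivity-15581), line `cold-floor-collapse`
# (slug `Sketch`) — calibration `cal_freeColdUniq`: UNIQ′ holds at the solvable corner `U = 0`

Support file (`--supports stmt-HubbardSuperconductivity-15581`; sorry-free; no definition). It proves the
registered calibration sub-goal `cal_freeColdUniq` of the line `Sketch`: at the solvable corner `U = 0`, for every
`β > 0`, `g > 0`, `μ` and box `H ≥ 0`, the maximisers over `|h| ≤ H` of `h ↦ I(β,μ,h) − h²/g` lie in `{h⋆, −h⋆}`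
for some `h⋆`, where `I(β,μ,h) = (1/4π²)∫₀^{2π}∫₀^{2π} [2log2/β − ξ + (1/β)log((1+cosh βE)/2)] dθ₂dθ₁`
(`ξ = −2(cos θ₁+cos θ₂) − μ`, `E² = ξ² + 8h²(cos θ₁−cos θ₂)²`) is the explicit free sourced limit pressure of
`cfl_freeSourcedPressure_limit` (this is the physics stub UNIQ′ at `U = 0`).

Chain: `I` depends on `h` through `s = h²` only; per mode `G(s) = (1/β)log((1+cosh β√(ξ²+sw))/2)`,
`w = 8(cos θ₁−cos θ₂)²`, has `dG/ds = (wβ/4)·T(βE/2)` with the `tanh` kernel `T(y) = ∫₀¹sech²(ty)dt = tanh y/y`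
(`cuq_hasDerivAt_modeG`), `T` is strictly decreasing on `[0,∞)` (`cuq_tanhKernel_strictAnti`) and `s ↦ E`
strictly increasing when `w > 0`, so `G` is strictly concave on `[0,∞)` (`cuq_modeG_strictConcaveOn`,
`StrictAntiOn.strictConcaveOn_of_deriv`); the midpoint defect `G((s+s')/2) − (G(s)+G(s'))/2` is `≥ 0`, and `> 0`
off the diagonals `cos θ₁ = cos θ₂` when `s ≠ s'`, hence its zone integral is positive
(`cuq_double_integral_pos`: for each `θ₁` the inner integrand is positive at `θ₂ = π` or `π/2`, so on an open
set of positive measure) and `s ↦ I(√s)` is strictly midpoint-concave (`cuq_midpoint_strict`). Two maximisers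
`h, h₀` of the (continuous, hence bounded on the box) objective with `h² ≠ h₀²` would be beaten at
`√((h²+h₀²)/2) ∈ [−H,H]`; so `h² = h₀²`, i.e. `h = ±|h₀|` (`cuq_argmax_even`).
[folklore: strict concavity of the BCS/BdG free energy in the squared gap at `U = 0`]
-/

set_option linter.dupNamespace false

namespace Summit.HubbardSuperconductivity.HubbardSuperconductivity.Theorems.TwSeededEnsembleEquivalenceR.ColdFloorLine

open Real MeasureTheory intervalIntegral Set

/-! ### The `tanh` kernel `T(y) = ∫₀¹ sech²(ty) dt = tanh y / y` is strictly decreasing on `[0,∞)` -/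

/-- `T(y₂) < T(y₁)` for `0 ≤ y₁ < y₂`, `T(y) = ∫₀¹ sech²(t y) dt` (each `sech²(t·)` is strictly decreasing on
`[0,∞)` for `t > 0`). [folklore] -/
theorem cuq_tanhKernel_strictAnti {y₁ y₂ : ℝ} (h₁ : 0 ≤ y₁) (h : y₁ < y₂) :
    ∫ t in (0 : ℝ)..1, 1 / Real.cosh (t * y₂) ^ 2 < ∫ t in (0 : ℝ)..1, 1 / Real.cosh (t * y₁) ^ 2 := by
  have hc : ∀ y : ℝ, Continuous fun t : ℝ => 1 / Real.cosh (t * y) ^ 2 := fun y =>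
    continuous_const.div (by fun_prop) fun t => (pow_pos (Real.cosh_pos _) 2).ne'
  rw [← sub_pos, ← intervalIntegral.integral_sub ((hc y₁).intervalIntegrable _ _) ((hc y₂).intervalIntegrable _ _)]
  refine intervalIntegral.intervalIntegral_pos_of_pos_on
    (((hc y₁).sub (hc y₂)).intervalIntegrable _ _) (fun t ht => ?_) zero_lt_one
  have hlt : Real.cosh (t * y₁) < Real.cosh (t * y₂) := by
    rw [Real.cosh_lt_cosh, abs_of_nonneg (mul_nonneg ht.1.le h₁), abs_of_nonneg (mul_nonneg ht.1.le (h₁.trans h.le))]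
    exact mul_lt_mul_of_pos_left h ht.1
  have h0 : 0 < Real.cosh (t * y₁) := Real.cosh_pos _
  rw [sub_pos]
  gcongr

/-! ### The per-mode function `G(x) = (1/β) log((1 + cosh β√(ξ² + x·w))/2)` is strictly concave in `x ≥ 0` -/

/-- `dG/dx = (wβ/4)·T(βE/2)` at a point with `E² = ξ² + x w > 0` (`E = √(ξ² + x w)`, `T` the `tanh` kernel,
so `dG/dx = (w/2E) tanh(βE/2)`). [folklore] -/
theorem cuq_hasDerivAt_modeG {β w ξ s : ℝ} (hβ : 0 < β) (hpos : 0 < ξ ^ 2 + s * w) :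
    HasDerivAt (fun x : ℝ => 1 / β * Real.log ((1 + Real.cosh (β * Real.sqrt (ξ ^ 2 + x * w))) / 2))
      (w * β / 4 * ∫ t in (0 : ℝ)..1, 1 / Real.cosh (t * (β * Real.sqrt (ξ ^ 2 + s * w) / 2)) ^ 2) s := by
  have hE0 : Real.sqrt (ξ ^ 2 + s * w) ≠ 0 := Real.sqrt_ne_zero'.2 hpos
  have h1 : HasDerivAt (fun x : ℝ => ξ ^ 2 + x * w) w s := by
    simpa using ((hasDerivAt_id s).mul_const w).const_add (ξ ^ 2)
  have hE : HasDerivAt (fun x : ℝ => Real.sqrt (ξ ^ 2 + x * w)) (w / (2 * Real.sqrt (ξ ^ 2 + s * w))) s :=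
    h1.sqrt hpos.ne'
  have hC : HasDerivAt (fun x : ℝ => (1 + Real.cosh (β * Real.sqrt (ξ ^ 2 + x * w))) / 2)
      (Real.sinh (β * Real.sqrt (ξ ^ 2 + s * w)) * (β * (w / (2 * Real.sqrt (ξ ^ 2 + s * w)))) / 2) s :=
    (((Real.hasDerivAt_cosh _).comp s (hE.const_mul β)).const_add 1).div_const 2
  have hc0 : (1 + Real.cosh (β * Real.sqrt (ξ ^ 2 + s * w))) / 2 ≠ 0 := by
    have := Real.cosh_pos (β * Real.sqrt (ξ ^ 2 + s * w)); positivity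
  have hc1 : 1 + Real.cosh (β * Real.sqrt (ξ ^ 2 + s * w)) ≠ 0 := by
    have := Real.cosh_pos (β * Real.sqrt (ξ ^ 2 + s * w)); positivity
  have hL := (hC.log hc0).const_mul (1 / β)
  refine hL.congr_deriv ?_
  have key := cfl_mul_tanhKernel (β * Real.sqrt (ξ ^ 2 + s * w) / 2)
  rw [cfl_tanh_half, eq_div_iff hc1] at key
  generalize (∫ t in (0 : ℝ)..1, 1 / Real.cosh (t * (β * Real.sqrt (ξ ^ 2 + s * w) / 2)) ^ 2) = T at key ⊢
  rw [← key]
  field_simp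
  ring

/-- `G` is strictly concave on `[0,∞)` when `β > 0`, `w > 0`: it is continuous and its derivative
`(wβ/4)·T(β√(ξ²+xw)/2)` is strictly decreasing on `(0,∞)`. [folklore] -/
theorem cuq_modeG_strictConcaveOn {β w : ℝ} (ξ : ℝ) (hβ : 0 < β) (hw : 0 < w) :
    StrictConcaveOn ℝ (Ici 0) (fun x : ℝ => 1 / β * Real.log ((1 + Real.cosh (β * Real.sqrt (ξ ^ 2 + x * w))) / 2)) := by
  apply StrictAntiOn.strictConcaveOn_of_deriv (convex_Ici 0)
  · have h3 : ∀ x : ℝ, (1 + Real.cosh (β * Real.sqrt (ξ ^ 2 + x * w))) / 2 ≠ 0 := fun x => by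
      have := Real.cosh_pos (β * Real.sqrt (ξ ^ 2 + x * w)); positivity
    have hc : Continuous fun x : ℝ => (1 + Real.cosh (β * Real.sqrt (ξ ^ 2 + x * w))) / 2 := by fun_prop
    exact (continuous_const.mul (hc.log h3)).continuousOn
  · rw [interior_Ici]
    intro x hx y hy hxy
    have hx0 : (0 : ℝ) < x := hx
    have hy0 : (0 : ℝ) < y := hy
    have hxp : 0 < ξ ^ 2 + x * w := by positivity
    have hyp : 0 < ξ ^ 2 + y * w := by positivity
    rw [(cuq_hasDerivAt_modeG hβ hxp).deriv, (cuq_hasDerivAt_modeG hβ hyp).deriv]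
    have hwb : 0 < w * β / 4 := by positivity
    refine mul_lt_mul_of_pos_left (cuq_tanhKernel_strictAnti (by positivity) ?_) hwb
    have h1 : Real.sqrt (ξ ^ 2 + x * w) < Real.sqrt (ξ ^ 2 + y * w) :=
      Real.sqrt_lt_sqrt hxp.le (by nlinarith [mul_lt_mul_of_pos_right hxy hw])
    nlinarith [mul_lt_mul_of_pos_left h1 hβ]

/-- Strict midpoint concavity of the mode pressure in the squared source (`w > 0`, `s ≠ s'`); the affine part
`A` cancels. [folklore] -/
theorem cuq_mode_midpoint_pos {β w : ℝ} (ξ : ℝ) (hβ : 0 < β) (hw : 0 < w) {s s' : ℝ} (hs : 0 ≤ s) (hs' : 0 ≤ s')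
    (hne : s ≠ s') (A : ℝ) :
    0 < (A + 1 / β * Real.log ((1 + Real.cosh (β * Real.sqrt (ξ ^ 2 + (s + s') / 2 * w))) / 2)) -
      ((A + 1 / β * Real.log ((1 + Real.cosh (β * Real.sqrt (ξ ^ 2 + s * w))) / 2)) +
        (A + 1 / β * Real.log ((1 + Real.cosh (β * Real.sqrt (ξ ^ 2 + s' * w))) / 2))) / 2 := by
  have h := (cuq_modeG_strictConcaveOn ξ hβ hw).2 (Set.mem_Ici.2 hs) (Set.mem_Ici.2 hs') hne
    (by norm_num : (0 : ℝ) < 1 / 2) (by norm_num : (0 : ℝ) < 1 / 2) (by norm_num)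
  simp only [smul_eq_mul] at h
  rw [show 1 / 2 * s + 1 / 2 * s' = (s + s') / 2 by ring] at h
  linarith

/-- Midpoint concavity of the mode pressure in the squared source (`w ≥ 0`). [folklore] -/
theorem cuq_mode_midpoint_nonneg {β w : ℝ} (ξ : ℝ) (hβ : 0 < β) (hw : 0 ≤ w) {s s' : ℝ} (hs : 0 ≤ s)
    (hs' : 0 ≤ s') (A : ℝ) :
    0 ≤ (A + 1 / β * Real.log ((1 + Real.cosh (β * Real.sqrt (ξ ^ 2 + (s + s') / 2 * w))) / 2)) -
      ((A + 1 / β * Real.log ((1 + Real.cosh (β * Real.sqrt (ξ ^ 2 + s * w))) / 2)) +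
        (A + 1 / β * Real.log ((1 + Real.cosh (β * Real.sqrt (ξ ^ 2 + s' * w))) / 2))) / 2 := by
  rcases hw.lt_or_eq with hw' | rfl
  · rcases eq_or_ne s s' with rfl | hss
    · rw [show (s + s) / 2 = s by ring]; linarith
    · exact (cuq_mode_midpoint_pos ξ hβ hw' hs hs' hss A).le
  · simp only [mul_zero]; linarith

/-- `(2√2·√s·d)² = s·(8d²)` for `s ≥ 0`. [folklore] -/
theorem cuq_gap_sq {s : ℝ} (hs : 0 ≤ s) (d : ℝ) : (2 * Real.sqrt 2 * Real.sqrt s * d) ^ 2 = s * (8 * d ^ 2) := by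
  rw [mul_pow, mul_pow, mul_pow, Real.sq_sqrt hs, Real.sq_sqrt (by norm_num : (0:ℝ) ≤ 2)]; ring

/-! ### Positivity and linearity of the zone integral -/

/-- A jointly continuous `Φ ≥ 0` on the torus which, for every `θ₁`, is positive at some `θ₂ ∈ (0,2π)`, has
positive iterated integral. [folklore] -/
theorem cuq_double_integral_pos (Φ : ℝ → ℝ → ℝ) (hc : Continuous (Function.uncurry Φ))
    (hnn : ∀ x y, 0 ≤ Φ x y) (hpos : ∀ x, ∃ y ∈ Ioo 0 (2 * π), 0 < Φ x y) :
    0 < ∫ x in (0 : ℝ)..2 * π, ∫ y in (0 : ℝ)..2 * π, Φ x y := by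
  have hΨ : Continuous fun x => ∫ y in (0 : ℝ)..2 * π, Φ x y :=
    intervalIntegral.continuous_parametric_intervalIntegral_of_continuous' hc 0 (2 * π)
  refine intervalIntegral.intervalIntegral_pos_of_pos_on (hΨ.intervalIntegrable _ _) (fun x _ => ?_)
    Real.two_pi_pos
  have hcx : Continuous (Φ x) := hc.uncurry_left x
  obtain ⟨y₀, hy₀, hy₀pos⟩ := hpos x
  rw [intervalIntegral.integral_pos_iff_support_of_nonneg_ae (Filter.Eventually.of_forall (hnn x))
    (hcx.intervalIntegrable _ _)]
  refine ⟨Real.two_pi_pos, ?_⟩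
  have hopen : IsOpen ({y | 0 < Φ x y} ∩ Ioo 0 (2 * π)) := (isOpen_lt continuous_const hcx).inter isOpen_Ioo
  refine (hopen.measure_pos volume ⟨y₀, hy₀pos, hy₀⟩).trans_le (measure_mono ?_)
  rintro y ⟨hy, hy'⟩
  exact ⟨(ne_of_gt hy : Φ x y ≠ 0), Ioo_subset_Ioc_self hy'⟩

/-- Linearity of the iterated integral for the midpoint defect of three jointly continuous integrands.
[folklore] -/
theorem cuq_double_integral_defect (p₁ p₂ p₃ : ℝ → ℝ → ℝ) (h₁ : Continuous (Function.uncurry p₁))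
    (h₂ : Continuous (Function.uncurry p₂)) (h₃ : Continuous (Function.uncurry p₃)) (a b : ℝ) :
    ∫ x in a..b, ∫ y in a..b, (p₁ x y - (p₂ x y + p₃ x y) / 2) =
      (∫ x in a..b, ∫ y in a..b, p₁ x y) -
        ((∫ x in a..b, ∫ y in a..b, p₂ x y) + (∫ x in a..b, ∫ y in a..b, p₃ x y)) / 2 := by
  have I₁ := intervalIntegral.continuous_parametric_intervalIntegral_of_continuous' (μ := volume) h₁ a b
  have I₂ := intervalIntegral.continuous_parametric_intervalIntegral_of_continuous' (μ := volume) h₂ a b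
  have I₃ := intervalIntegral.continuous_parametric_intervalIntegral_of_continuous' (μ := volume) h₃ a b
  have inner : ∀ x, ∫ y in a..b, (p₁ x y - (p₂ x y + p₃ x y) / 2) =
      (∫ y in a..b, p₁ x y) - ((∫ y in a..b, p₂ x y) + (∫ y in a..b, p₃ x y)) / 2 := fun x => by
    rw [intervalIntegral.integral_sub ((h₁.uncurry_left x).intervalIntegrable _ _)
        ((((h₂.uncurry_left x).fun_add (h₃.uncurry_left x)).div_const 2).intervalIntegrable _ _),
      intervalIntegral.integral_div, intervalIntegral.integral_add ((h₂.uncurry_left x).intervalIntegrable _ _)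
        ((h₃.uncurry_left x).intervalIntegrable _ _)]
  simp_rw [inner]
  rw [intervalIntegral.integral_sub (I₁.intervalIntegrable _ _) (((I₂.fun_add I₃).div_const 2).intervalIntegrable _ _),
    intervalIntegral.integral_div, intervalIntegral.integral_add (I₂.intervalIntegrable _ _) (I₃.intervalIntegrable _ _)]

/-- **Strict midpoint inequality for zone averages**: if `p₁ − (p₂ + p₃)/2 ≥ 0` is jointly continuous and, for
every `θ₁`, positive at some `θ₂ ∈ (0,2π)`, then `(avg p₂ + avg p₃)/2 < avg p₁`. [folklore] -/
theorem cuq_double_integral_midpoint (p₁ p₂ p₃ : ℝ → ℝ → ℝ) (h₁ : Continuous (Function.uncurry p₁))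
    (h₂ : Continuous (Function.uncurry p₂)) (h₃ : Continuous (Function.uncurry p₃))
    (hnn : ∀ x y, 0 ≤ p₁ x y - (p₂ x y + p₃ x y) / 2)
    (hpos : ∀ x, ∃ y ∈ Ioo 0 (2 * π), 0 < p₁ x y - (p₂ x y + p₃ x y) / 2) {c : ℝ} (hc : 0 < c) :
    ((∫ x in (0 : ℝ)..2 * π, ∫ y in (0 : ℝ)..2 * π, p₂ x y) / c +
        (∫ x in (0 : ℝ)..2 * π, ∫ y in (0 : ℝ)..2 * π, p₃ x y) / c) / 2 <
      (∫ x in (0 : ℝ)..2 * π, ∫ y in (0 : ℝ)..2 * π, p₁ x y) / c := by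
  have hΦ : Continuous (Function.uncurry fun x y => p₁ x y - (p₂ x y + p₃ x y) / 2) :=
    h₁.sub ((h₂.add h₃).div_const 2)
  have key := cuq_double_integral_pos _ hΦ hnn hpos
  beta_reduce at key
  rw [cuq_double_integral_defect p₁ p₂ p₃ h₁ h₂ h₃] at key
  have e : ∀ A B C : ℝ, A / c - (B / c + C / c) / 2 = (A - (B + C) / 2) / c := fun A B C => by ring
  rw [← sub_pos, e]
  exact div_pos key hc

/-! ### Assembly -/

/-- If `f` is even, strictly midpoint-concave in `s = h²` (`s ≥ 0`), and bounded above on `[−H, H]`, then its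
maximisers over `[−H, H]` are contained in `{h⋆, −h⋆}` for some `h⋆`. [folklore] -/
theorem cuq_argmax_even (f : ℝ → ℝ) (H : ℝ) (habs : ∀ h, f |h| = f h)
    (hmid : ∀ s s', 0 ≤ s → 0 ≤ s' → s ≠ s' → (f (Real.sqrt s) + f (Real.sqrt s')) / 2 < f (Real.sqrt ((s + s') / 2)))
    (hbdd : BddAbove (f '' Icc (-H) H)) :
    ∃ hstar : ℝ, ∀ h ∈ Icc (-H) H, f h = sSup (f '' Icc (-H) H) → h = hstar ∨ h = -hstar := by
  by_cases hex : ∃ h₀ ∈ Icc (-H) H, f h₀ = sSup (f '' Icc (-H) H)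
  · obtain ⟨h₀, hh₀, hf₀⟩ := hex
    refine ⟨|h₀|, fun h hh hfh => ?_⟩
    have hsq : h ^ 2 = h₀ ^ 2 := by
      by_contra hne
      have hHnn : 0 ≤ H := by linarith [hh.1, hh.2]
      have hmem : Real.sqrt ((h ^ 2 + h₀ ^ 2) / 2) ∈ Icc (-H) H := by
        refine ⟨by linarith [Real.sqrt_nonneg ((h ^ 2 + h₀ ^ 2) / 2)], ?_⟩
        calc Real.sqrt ((h ^ 2 + h₀ ^ 2) / 2) ≤ Real.sqrt (H ^ 2) :=
              Real.sqrt_le_sqrt (by linarith [sq_le_sq' hh.1 hh.2, sq_le_sq' hh₀.1 hh₀.2])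
          _ = H := Real.sqrt_sq hHnn
      have hle : f (Real.sqrt ((h ^ 2 + h₀ ^ 2) / 2)) ≤ sSup (f '' Icc (-H) H) := le_csSup hbdd ⟨_, hmem, rfl⟩
      have hlt := hmid (h ^ 2) (h₀ ^ 2) (sq_nonneg _) (sq_nonneg _) hne
      rw [Real.sqrt_sq_eq_abs, Real.sqrt_sq_eq_abs, habs, habs, hfh, hf₀] at hlt
      linarith
    exact (abs_eq (abs_nonneg h₀)).1 ((sq_eq_sq_iff_abs_eq_abs h h₀).1 hsq)
  · exact ⟨0, fun h hh hfh => (hex ⟨h, hh, hfh⟩).elim⟩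

/-! ### The free sourced limit pressure: continuity in `h` and strict midpoint concavity in `s = h²` -/

/-- The objective `h ↦ I(β,μ,h) − h²/g` (free sourced limit pressure minus the source cost) is continuous: the
pressure integrand is jointly continuous in `(h, θ₁, θ₂)`. [folklore] -/
theorem cuq_continuous_objective (β μ g : ℝ) :
    Continuous fun h : ℝ => ((∫ θ₁ in (0 : ℝ)..2 * π, ∫ θ₂ in (0 : ℝ)..2 * π, (2 * Real.log 2 / β - (-2 * (Real.cos θ₁ + Real.cos θ₂) - μ) + 1 / β * Real.log ((1 + Real.cosh (β * Real.sqrt ((-2 * (Real.cos θ₁ + Real.cos θ₂) - μ) ^ 2 + (2 * Real.sqrt 2 * h * (Real.cos θ₁ - Real.cos θ₂)) ^ 2))) / 2))) / (4 * π ^ 2)) - h ^ 2 / g := by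
  have h3 : Continuous (Function.uncurry fun (q : ℝ × ℝ) (θ₂ : ℝ) => 2 * Real.log 2 / β - (-2 * (Real.cos q.2 + Real.cos θ₂) - μ) + 1 / β * Real.log ((1 + Real.cosh (β * Real.sqrt ((-2 * (Real.cos q.2 + Real.cos θ₂) - μ) ^ 2 + (2 * Real.sqrt 2 * q.1 * (Real.cos q.2 - Real.cos θ₂)) ^ 2))) / 2)) := by
    show Continuous fun p : (ℝ × ℝ) × ℝ => 2 * Real.log 2 / β - (-2 * (Real.cos p.1.2 + Real.cos p.2) - μ) + 1 / β * Real.log ((1 + Real.cosh (β * Real.sqrt ((-2 * (Real.cos p.1.2 + Real.cos p.2) - μ) ^ 2 + (2 * Real.sqrt 2 * p.1.1 * (Real.cos p.1.2 - Real.cos p.2)) ^ 2))) / 2)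
    have hne : ∀ p : (ℝ × ℝ) × ℝ, (1 + Real.cosh (β * Real.sqrt ((-2 * (Real.cos p.1.2 + Real.cos p.2) - μ) ^ 2 + (2 * Real.sqrt 2 * p.1.1 * (Real.cos p.1.2 - Real.cos p.2)) ^ 2))) / 2 ≠ 0 := fun p => by
      have := Real.cosh_pos (β * Real.sqrt ((-2 * (Real.cos p.1.2 + Real.cos p.2) - μ) ^ 2 + (2 * Real.sqrt 2 * p.1.1 * (Real.cos p.1.2 - Real.cos p.2)) ^ 2))
      positivity
    have hc : Continuous fun p : (ℝ × ℝ) × ℝ => (1 + Real.cosh (β * Real.sqrt ((-2 * (Real.cos p.1.2 + Real.cos p.2) - μ) ^ 2 + (2 * Real.sqrt 2 * p.1.1 * (Real.cos p.1.2 - Real.cos p.2)) ^ 2))) / 2 := by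
      fun_prop
    have hA : Continuous fun p : (ℝ × ℝ) × ℝ => 2 * Real.log 2 / β - (-2 * (Real.cos p.1.2 + Real.cos p.2) - μ) := by fun_prop
    exact hA.fun_add (continuous_const.fun_mul (hc.log hne))
  have h2 : Continuous (Function.uncurry fun (h θ₁ : ℝ) => ∫ θ₂ in (0 : ℝ)..2 * π, (2 * Real.log 2 / β - (-2 * (Real.cos θ₁ + Real.cos θ₂) - μ) + 1 / β * Real.log ((1 + Real.cosh (β * Real.sqrt ((-2 * (Real.cos θ₁ + Real.cos θ₂) - μ) ^ 2 + (2 * Real.sqrt 2 * h * (Real.cos θ₁ - Real.cos θ₂)) ^ 2))) / 2))) :=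
    intervalIntegral.continuous_parametric_intervalIntegral_of_continuous' h3 0 (2 * π)
  have h1 : Continuous fun h : ℝ => ∫ θ₁ in (0 : ℝ)..2 * π, ∫ θ₂ in (0 : ℝ)..2 * π, (2 * Real.log 2 / β - (-2 * (Real.cos θ₁ + Real.cos θ₂) - μ) + 1 / β * Real.log ((1 + Real.cosh (β * Real.sqrt ((-2 * (Real.cos θ₁ + Real.cos θ₂) - μ) ^ 2 + (2 * Real.sqrt 2 * h * (Real.cos θ₁ - Real.cos θ₂)) ^ 2))) / 2)) :=
    intervalIntegral.continuous_parametric_intervalIntegral_of_continuous' h2 0 (2 * π)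
  exact (h1.div_const _).fun_sub ((continuous_pow 2).div_const g)

/-- **Strict midpoint concavity of the free sourced limit pressure in `s = h²`**: for `0 ≤ s ≠ s' ≥ 0`,
`(I(√s) + I(√s'))/2 < I(√((s+s')/2))`. Per mode the defect is `≥ 0` (concavity of
`s ↦ (1/β)log((1+cosh β√(ξ²+8s(cos θ₁−cos θ₂)²))/2)`) and `> 0` off the diagonals `cos θ₁ = cos θ₂`, so the
zone integral of the defect is positive. [folklore] -/
theorem cuq_midpoint_strict (β μ : ℝ) (hβ : 0 < β) {s s' : ℝ} (hs : 0 ≤ s) (hs' : 0 ≤ s') (hne : s ≠ s') :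
    (((∫ θ₁ in (0 : ℝ)..2 * π, ∫ θ₂ in (0 : ℝ)..2 * π, (2 * Real.log 2 / β - (-2 * (Real.cos θ₁ + Real.cos θ₂) - μ) + 1 / β * Real.log ((1 + Real.cosh (β * Real.sqrt ((-2 * (Real.cos θ₁ + Real.cos θ₂) - μ) ^ 2 + (2 * Real.sqrt 2 * Real.sqrt s * (Real.cos θ₁ - Real.cos θ₂)) ^ 2))) / 2))) / (4 * π ^ 2)) + ((∫ θ₁ in (0 : ℝ)..2 * π, ∫ θ₂ in (0 : ℝ)..2 * π, (2 * Real.log 2 / β - (-2 * (Real.cos θ₁ + Real.cos θ₂) - μ) + 1 / β * Real.log ((1 + Real.cosh (β * Real.sqrt ((-2 * (Real.cos θ₁ + Real.cos θ₂) - μ) ^ 2 + (2 * Real.sqrt 2 * Real.sqrt s' * (Real.cos θ₁ - Real.cos θ₂)) ^ 2))) / 2))) / (4 * π ^ 2))) / 2 < ((∫ θ₁ in (0 : ℝ)..2 * π, ∫ θ₂ in (0 : ℝ)..2 * π, (2 * Real.log 2 / β - (-2 * (Real.cos θ₁ + Real.cos θ₂) - μ) + 1 / β * Real.log ((1 + Real.cosh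 (β * Real.sqrt ((-2 * (Real.cos θ₁ + Real.cos θ₂) - μ) ^ 2 + (2 * Real.sqrt 2 * Real.sqrt ((s + s') / 2) * (Real.cos θ₁ - Real.cos θ₂)) ^ 2))) / 2))) / (4 * π ^ 2)) := by
  have hm : (0 : ℝ) ≤ (s + s') / 2 := by positivity
  refine cuq_double_integral_midpoint _ _ _ (cfl_continuous_bdgPressureDensity β μ _)
    (cfl_continuous_bdgPressureDensity β μ _) (cfl_continuous_bdgPressureDensity β μ _) (fun θ₁ θ₂ => ?_)
    (fun θ₁ => ?_) (by positivity)
  · simp only [cuq_gap_sq hm, cuq_gap_sq hs, cuq_gap_sq hs']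
    exact cuq_mode_midpoint_nonneg _ hβ (by positivity) hs hs' _
  · by_cases hc : Real.cos θ₁ = -1
    · refine ⟨π / 2, ⟨by positivity, by linarith [Real.pi_pos]⟩, ?_⟩
      simp only [cuq_gap_sq hm, cuq_gap_sq hs, cuq_gap_sq hs']
      refine cuq_mode_midpoint_pos _ hβ ?_ hs hs' hne _
      rw [Real.cos_pi_div_two, hc]; norm_num
    · refine ⟨π, ⟨Real.pi_pos, by linarith [Real.pi_pos]⟩, ?_⟩
      simp only [cuq_gap_sq hm, cuq_gap_sq hs, cuq_gap_sq hs']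
      refine cuq_mode_midpoint_pos _ hβ ?_ hs hs' hne _
      rw [Real.cos_pi]
      have : Real.cos θ₁ + 1 ≠ 0 := fun h => hc (by linarith)
      positivity

/-! ### The calibration theorem -/

/-- **Calibration of UNIQ′ at `U = 0`** (registered sub-goal `cal_freeColdUniq` of the line `Sketch`): for every
`β > 0`, `g > 0`, `μ` and box `H ≥ 0`, the maximisers over `|h| ≤ H` of `h ↦ I(β,μ,h) − h²/g`, `I` the explicit
free sourced limit pressure (`cfl_freeSourcedPressure_limit`), lie in `{h⋆, −h⋆}` for some `h⋆`: `I` depends on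
`h` through `s = h²` only and is strictly midpoint-concave in `s` (`cuq_midpoint_strict`), so two maximisers
with `h² ≠ h₀²` would be beaten by `h = √((h² + h₀²)/2)`. [folklore: BCS gap-equation uniqueness at `U = 0`] -/
theorem cal_freeColdUniq : ∀ (β μ g H : ℝ), 0 < β → 0 < g → 0 ≤ H → ∃ hstar : ℝ, ∀ h ∈ Set.Icc (-H) H, ((∫ θ₁ in (0 : ℝ)..2 * π, ∫ θ₂ in (0 : ℝ)..2 * π, (2 * Real.log 2 / β - (-2 * (Real.cos θ₁ + Real.cos θ₂) - μ) + 1 / β * Real.log ((1 + Real.cosh (β * Real.sqrt ((-2 * (Real.cos θ₁ + Real.cos θ₂) - μ) ^ 2 + (2 * Real.sqrt 2 * h * (Real.cos θ₁ - Real.cos θ₂)) ^ 2))) / 2))) / (4 * π ^ 2)) - h ^ 2 / g = sSup ((fun h' : ℝ => ((∫ θ₁ in (0 : ℝ)..2 * π, ∫ θ₂ in (0 : ℝ)..2 * π, (2 * Real.log 2 / β - (-2 * (Real.cos θ₁ + Real.cos θ₂) - μ) + 1 / β * Real.log ((1 + Real.cosh (β * Real.sqrt ((-2 * (Real.cos θ₁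 + Real.cos θ₂) - μ) ^ 2 + (2 * Real.sqrt 2 * h' * (Real.cos θ₁ - Real.cos θ₂)) ^ 2))) / 2))) / (4 * π ^ 2)) - h' ^ 2 / g) '' Set.Icc (-H) H) → h = hstar ∨ h = -hstar := by
  intro β μ g H hβ _ _
  refine cuq_argmax_even (fun h' : ℝ => ((∫ θ₁ in (0 : ℝ)..2 * π, ∫ θ₂ in (0 : ℝ)..2 * π, (2 * Real.log 2 / β - (-2 * (Real.cos θ₁ + Real.cos θ₂) - μ) + 1 / β * Real.log ((1 + Real.cosh (β * Real.sqrt ((-2 * (Real.cos θ₁ + Real.cos θ₂) - μ) ^ 2 + (2 * Real.sqrt 2 * h' * (Real.cos θ₁ - Real.cos θ₂)) ^ 2))) / 2))) / (4 * π ^ 2)) - h' ^ 2 / g) H (fun h => ?_) (fun s s' hs hs' hne => ?_)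
    (isCompact_Icc.bddAbove_image (cuq_continuous_objective β μ g).continuousOn)
  · have e : ∀ d : ℝ, (2 * Real.sqrt 2 * |h| * d) ^ 2 = (2 * Real.sqrt 2 * h * d) ^ 2 := fun d => by
      simp only [mul_pow, sq_abs]
    simp only [e, sq_abs]
  · have key := cuq_midpoint_strict β μ hβ hs hs' hne
    simp only [Real.sq_sqrt hs, Real.sq_sqrt hs', Real.sq_sqrt (by positivity : (0 : ℝ) ≤ (s + s') / 2)]
    have e : (s / g + s' / g) / 2 = (s + s') / 2 / g := by ring
    linarith

end Summit.HubbardSuperconductivity.HubbardSuperconductivity.Theorems.TwSeededEnsembleEquivalenceR.ColdFloorLine
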